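import Mathlib
import Literature.Analysis.FluidPDE.WholeSpaceIBP
import Literature.Analysis.FluidPDE.ClassicalSolutionCalculus
import HarnessLib

/-!
# Crux `NoFrozenEddyCollapse` (stmt-NavierStokesRegularity-1431), line `SketchIdeator1`:
  STUB `stub_cokernelEnergy` (the energy cokernel family `φ_f = f(B) U`)

Helper file (lands `--supports stmt-NavierStokesRegularity-1431`) for the registered stub
`stub_cokernelEnergy` of the skeleton `NoFrozenEddyCollapse` (card `shell-balance-edge-torsion`).

Let `(U, P)` be a smooth, compactly supported steady Euler flow on `ℝ³` (`DU·U + ∇P = 0`,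
`div U = 0`), `B = P + ‖U‖²/2` its Bernoulli head and `f : ℝ → ℝ` smooth.  The field
`φ_f = f(B) U` is smooth, compactly supported inside `tsupport U`, divergence free, and for every
`C¹` divergence-free `W` (no decay assumed) `∫ (⟪U, Dφ_f W⟫ + ⟪W, Dφ_f U⟫) = 0`.

Proof outline.
* Bernoulli: `DB(y)v = DP(y)v + ⟪U y, DU(y)v⟫`, hence `DB·U = ⟪∇P + DU·U, U⟫ = 0`; and `DB = 0`
  off `tsupport U` (there `U = 0`, `DU = 0`, `∇P = -DU·U = 0`).
* `div φ_f = f(B) div U + f′(B) DB·U = 0` (`divergence_smul_apply`), and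
  `Dφ_f·U = f(B) DU·U + (f′(B) DB·U) U = -f(B) ∇P`.
* By parts (`integral_inner_convect_add_eq_zero`, `div W = 0`): `∫ ⟪U, Dφ_f W⟫ = -∫ ⟪DU W, φ_f⟫`,
  so the pairing equals `-∫ f(B) (DP·W + ⟪U, DU W⟫) = -∫ f(B) DB·W`.
* `f(B) DB = D(F∘B)` with `F(s) = ∫₀ˢ f` (FTC).  `D(F∘B) = 0` off `tsupport U ⊆ closedBall 0 ρ`,
  and the exterior of a closed ball is preconnected in dimension `> 1` (continuous image of
  `sphere × (ρ, ∞)`), so `F∘B ≡ c` there (`IsOpen.exists_is_const_of_fderiv_eq_zero`);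
  `Ψ = F∘B - c ∈ C¹_c` and `∫ ⟪W, ∇Ψ⟫ = -∫ Ψ div W = 0`
  (`integral_mul_divergence_add_eq_zero_left`).
Mathlib + `Literature.Analysis.FluidPDE.WholeSpaceIBP` only.
-/

noncomputable section

open MeasureTheory Set Filter Topology Metric Function
open scoped RealInnerProductSpace

namespace Summit.NavierStokesRegularity.NavierStokesRegularity.Theorems.NoFrozenEddyCollapse.ShellBalanceEdgeTorsion

open Literature.Analysis.FluidPDE

section Generic

variable {E : Type*} [NormedAddCommGroup E] [InnerProductSpace ℝ E]

/-- Derivative of the Bernoulli head `B = P + ‖U‖²/2`: `DB(y)v = DP(y)v + ⟪U y, DU(y)v⟫`. -/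
private theorem fderiv_head_apply {U : E → E} {P : E → ℝ} (hU : Differentiable ℝ U)
    (hP : Differentiable ℝ P) (y v : E) :
    fderiv ℝ (fun z => P z + ‖U z‖ ^ 2 / 2) y v = fderiv ℝ P y v + ⟪U y, fderiv ℝ U y v⟫ := by
  have hfun : (fun z => P z + ‖U z‖ ^ 2 / 2) = fun z => P z + ‖U z‖ ^ 2 * (2 : ℝ)⁻¹ := by
    funext z; ring
  rw [hfun, ((hP y).hasFDerivAt.fun_add ((hU y).hasFDerivAt.norm_sq.mul_const (2 : ℝ)⁻¹)).fderiv]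
  simp only [_root_.add_apply, _root_.smul_apply, ContinuousLinearMap.comp_apply,
    innerSL_apply_apply, smul_eq_mul, nsmul_eq_mul, Nat.cast_ofNat]
  ring

/-- The Bernoulli head is smooth when `U` and `P` are. -/
private theorem contDiff_head {U : E → E} {P : E → ℝ} {n : ℕ∞} (hU : ContDiff ℝ n U)
    (hP : ContDiff ℝ n P) : ContDiff ℝ n (fun z => P z + ‖U z‖ ^ 2 / 2) :=
  hP.add ((hU.norm_sq ℝ).div_const 2)

/-- In dimension `> 1` the exterior of a closed ball of nonnegative radius is preconnected: it is
the continuous image `(s, t) ↦ t • s` of `sphere 0 1 × (ρ, ∞)`. -/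
private theorem isPreconnected_compl_closedBall (hE : 1 < Module.rank ℝ E) {ρ : ℝ}
    (hρ : 0 ≤ ρ) : IsPreconnected (closedBall (0 : E) ρ)ᶜ := by
  have himage : (fun p : E × ℝ => p.2 • p.1) '' (sphere (0 : E) 1 ×ˢ Ioi ρ) =
      (closedBall (0 : E) ρ)ᶜ := by
    ext z
    rw [mem_compl_iff, mem_closedBall_zero_iff, not_le]
    constructor
    · rintro ⟨⟨s, t⟩, ⟨hs, ht⟩, rfl⟩
      rw [mem_sphere_zero_iff_norm] at hs
      change ρ < t at ht
      show ρ < ‖t • s‖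
      rw [norm_smul, hs, mul_one, Real.norm_of_nonneg (hρ.trans ht.le)]
      exact ht
    · intro hz
      have hn : ‖z‖ ≠ 0 := (hρ.trans_lt hz).ne'
      refine ⟨(‖z‖⁻¹ • z, ‖z‖), ⟨?_, hz⟩, ?_⟩
      · show ‖z‖⁻¹ • z ∈ sphere (0 : E) 1
        rw [mem_sphere_zero_iff_norm, norm_smul, norm_inv, norm_norm, inv_mul_cancel₀ hn]
      · show ‖z‖ • ‖z‖⁻¹ • z = z
        rw [smul_smul, mul_inv_cancel₀ hn, one_smul]
  rw [← himage]
  exact ((isPreconnected_sphere hE 0 1).prod isPreconnected_Ioi).image _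
    (continuous_snd.smul continuous_fst).continuousOn

/-- The primitive `F(s) = ∫₀ˢ f` of a smooth `f : ℝ → ℝ` is smooth (FTC: `F′ = f`). -/
private theorem contDiff_primitive {f : ℝ → ℝ} (hf : ContDiff ℝ (⊤ : ℕ∞) f) :
    ContDiff ℝ (⊤ : ℕ∞) fun s => ∫ r in (0 : ℝ)..s, f r := by
  have hd : ∀ s, HasDerivAt (fun s => ∫ r in (0 : ℝ)..s, f r) (f s) s := fun s =>
    (hf.continuous.integral_hasStrictDerivAt 0 s).hasDerivAt
  have hderiv : deriv (fun s => ∫ r in (0 : ℝ)..s, f r) = f := funext fun s => (hd s).deriv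
  refine contDiff_infty_iff_deriv.2 ⟨fun s => (hd s).differentiableAt, ?_⟩
  rw [hderiv]
  exact hf

variable [FiniteDimensional ℝ E]

/-- **Bernoulli's theorem** for a steady Euler flow: the head is constant along streamlines,
`DB(y)(U y) = ⟪∇P(y) + DU(y)U(y), U(y)⟫ = 0`. -/
private theorem fderiv_head_apply_self {U : E → E} {P : E → ℝ} (hU : Differentiable ℝ U)
    (hP : Differentiable ℝ P) (hE : ∀ x, convect U U x + gradient P x = 0) (y : E) :
    fderiv ℝ (fun z => P z + ‖U z‖ ^ 2 / 2) y (U y) = 0 := by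
  have h1 : fderiv ℝ P y (U y) = ⟪gradient P y, U y⟫ := by
    rw [gradient, InnerProductSpace.toDual_symm_apply]
  have h2 : gradient P y = -convect U U y := eq_neg_of_add_eq_zero_right (hE y)
  rw [fderiv_head_apply hU hP, h1, h2, convect_apply, inner_neg_left,
    real_inner_comm (U y) (fderiv ℝ U y (U y)), neg_add_cancel]

/-- Off `tsupport U` the head has zero derivative: there `U = 0`, `DU = 0` and
`∇P = -DU·U = 0`. -/
private theorem fderiv_head_eq_zero {U : E → E} {P : E → ℝ} (hU : Differentiable ℝ U)
    (hP : Differentiable ℝ P) (hE : ∀ x, convect U U x + gradient P x = 0) {y : E}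
    (hy : y ∉ tsupport U) : fderiv ℝ (fun z => P z + ‖U z‖ ^ 2 / 2) y = 0 := by
  have hDU : fderiv ℝ U y = 0 := fderiv_of_notMem_tsupport ℝ hy
  have hgP : gradient P y = 0 := by
    have h := hE y
    rwa [convect_apply, hDU, _root_.zero_apply, zero_add] at h
  have hDP : fderiv ℝ P y = 0 := by simpa [gradient] using hgP
  ext v
  rw [fderiv_head_apply hU hP, hDP, hDU]
  simp

variable [MeasurableSpace E] [BorelSpace E]

/-- **The potential step.** If `B : E → ℝ` is smooth with `DB = 0` off a compact set `K`, `f` is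
smooth and `W` is `C¹` and divergence free, then `∫ f(B y) DB(y)(W y) dy = 0`: the integrand is
`⟪W, ∇Ψ⟫` for the compactly supported `C¹` potential `Ψ = F∘B - c`, `F = ∫₀ f`, `c` the constant
value of `F∘B` outside a ball containing `K` (dimension `> 1`), and `∫ ⟪W, ∇Ψ⟫ = -∫ Ψ div W = 0`. -/
private theorem integral_mul_fderiv_apply_eq_zero (hE : 1 < Module.rank ℝ E) {B : E → ℝ}
    {f : ℝ → ℝ} {W : E → E} {K : Set E} (hB : ContDiff ℝ (⊤ : ℕ∞) B) (hK : IsCompact K)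
    (hBK : ∀ y, y ∉ K → fderiv ℝ B y = 0) (hf : ContDiff ℝ (⊤ : ℕ∞) f) (hW : ContDiff ℝ 1 W)
    (hWdiv : VectorCalculus.IsDivFree W) :
    ∫ y, f (B y) * fderiv ℝ B y (W y) = 0 := by
  have hBd : Differentiable ℝ B :=
    (hB.of_le (by exact_mod_cast le_top) : ContDiff ℝ 1 B).differentiable one_ne_zero
  -- the primitive `Θ = F ∘ B`, `F = ∫₀ f`
  have hΘs : ContDiff ℝ (⊤ : ℕ∞) fun y => ∫ r in (0 : ℝ)..B y, f r :=
    (contDiff_primitive hf).comp hB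
  have hΘd : ∀ y, HasFDerivAt (fun y => ∫ r in (0 : ℝ)..B y, f r) (f (B y) • fderiv ℝ B y) y :=
    fun y => (hf.continuous.integral_hasStrictDerivAt 0 (B y)).hasDerivAt.comp_hasFDerivAt y
      (hBd y).hasFDerivAt
  -- a ball containing `K`; outside it `Θ` is constant
  obtain ⟨ρ, hρ, hKρ⟩ := hK.isBounded.subset_closedBall_lt 0 (0 : E)
  obtain ⟨c, hc⟩ : ∃ c, ∀ y ∈ (closedBall (0 : E) ρ)ᶜ, (∫ r in (0 : ℝ)..B y, f r) = c :=
    isClosed_closedBall.isOpen_compl.exists_is_const_of_fderiv_eq_zero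
      (isPreconnected_compl_closedBall hE hρ.le)
      (fun y _ => (hΘd y).differentiableAt.differentiableWithinAt) fun y hy => by
        have hy' : y ∉ K := fun h => hy (hKρ h)
        show fderiv ℝ (fun y => ∫ r in (0 : ℝ)..B y, f r) y = 0
        rw [(hΘd y).fderiv, hBK y hy', smul_zero]
  -- the compactly supported potential `Ψ = Θ - c`
  have hΨ1 : ContDiff ℝ 1 fun y => (∫ r in (0 : ℝ)..B y, f r) - c :=
    (hΘs.sub contDiff_const).of_le (by exact_mod_cast le_top)
  have hΨc : HasCompactSupport fun y => (∫ r in (0 : ℝ)..B y, f r) - c :=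
    HasCompactSupport.intro (isCompact_closedBall 0 ρ) fun y hy => sub_eq_zero.2 (hc y hy)
  have hibp := integral_mul_divergence_add_eq_zero_left hΨ1 hW hΨc
  have hW0 : ∀ x, VectorCalculus.divergence W x = 0 := hWdiv
  simp only [hW0, mul_zero, integral_zero, zero_add] at hibp
  refine (integral_congr_ae (Eventually.of_forall fun y => ?_)).trans hibp
  rw [real_inner_comm, gradient, InnerProductSpace.toDual_symm_apply, fderiv_sub_const,
    (hΘd y).fderiv, _root_.smul_apply, smul_eq_mul]

/-- **Reduction of the cokernel pairing by parts.** Let `U ∈ C¹_c`, `DU·U + ∇P = 0`, and let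
`φ ∈ C¹_c` with `φ = θ U` pointwise and `Dφ·U = -θ ∇P`. Then for every `C¹` divergence-free `W`,
`∫ (⟪U, Dφ W⟫ + ⟪W, Dφ U⟫) = -∫ θ (DP·W + ⟪U, DU W⟫)`: the first term is `-∫ ⟪DU W, φ⟫` by the
trilinear identity `integral_inner_convect_add_eq_zero` (`div W = 0`), the second is pointwise
`-θ ⟪W, ∇P⟫`. -/
private theorem integral_cokernel_pairing {U W φ : E → E} {P θ : E → ℝ} (hU : ContDiff ℝ 1 U)
    (hUc : HasCompactSupport U) (hφ : ContDiff ℝ 1 φ) (hφc : HasCompactSupport φ)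
    (hφU : ∀ y, φ y = θ y • U y) (hDφU : ∀ y, fderiv ℝ φ y (U y) = -(θ y • gradient P y))
    (hW : ContDiff ℝ 1 W) (hWdiv : VectorCalculus.IsDivFree W) :
    ∫ y, (⟪U y, fderiv ℝ φ y (W y)⟫ + ⟪W y, fderiv ℝ φ y (U y)⟫) =
      -∫ y, θ y * (fderiv ℝ P y (W y) + ⟪U y, fderiv ℝ U y (W y)⟫) := by
  -- by parts: `∫ ⟪DU W, φ⟫ + ∫ ⟪U, Dφ W⟫ = 0`
  have hparts := integral_inner_convect_add_eq_zero hW hU hφ hφc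
  have hW0 : ∀ x, VectorCalculus.divergence W x = 0 := hWdiv
  simp only [convect_apply, hW0, zero_mul, integral_zero, add_zero] at hparts
  -- integrability (continuous integrands with compact support)
  have hiA : Integrable (fun y => ⟪U y, fderiv ℝ φ y (W y)⟫) := by
    refine (hU.continuous.inner ((hφ.continuous_fderiv one_ne_zero).clm_apply hW.continuous))
      |>.integrable_of_hasCompactSupport ((hφc.fderiv (𝕜 := ℝ)).mono fun x hx => ?_)
    contrapose! hx
    simp only [mem_support, not_not] at hx ⊢
    simp [hx]
  have hiB : Integrable (fun y => ⟪W y, fderiv ℝ φ y (U y)⟫) := by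
    refine (hW.continuous.inner ((hφ.continuous_fderiv one_ne_zero).clm_apply hU.continuous))
      |>.integrable_of_hasCompactSupport (hUc.mono fun x hx => ?_)
    contrapose! hx
    simp only [mem_support, not_not] at hx ⊢
    simp [hx]
  have hiC : Integrable (fun y => ⟪fderiv ℝ U y (W y), φ y⟫) := by
    refine (((hU.continuous_fderiv one_ne_zero).clm_apply hW.continuous).inner hφ.continuous)
      |>.integrable_of_hasCompactSupport (hφc.mono fun x hx => ?_)
    contrapose! hx
    simp only [mem_support, not_not] at hx ⊢
    simp [hx]
  calc ∫ y, (⟪U y, fderiv ℝ φ y (W y)⟫ + ⟪W y, fderiv ℝ φ y (U y)⟫)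
      = (∫ y, ⟪U y, fderiv ℝ φ y (W y)⟫) + ∫ y, ⟪W y, fderiv ℝ φ y (U y)⟫ := integral_add hiA hiB
    _ = -((∫ y, ⟪fderiv ℝ U y (W y), φ y⟫) - ∫ y, ⟪W y, fderiv ℝ φ y (U y)⟫) := by linarith
    _ = -∫ y, (⟪fderiv ℝ U y (W y), φ y⟫ - ⟪W y, fderiv ℝ φ y (U y)⟫) := by
      rw [integral_sub hiC hiB]
    _ = -∫ y, θ y * (fderiv ℝ P y (W y) + ⟪U y, fderiv ℝ U y (W y)⟫) := by
      congr 1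
      refine integral_congr_ae (Eventually.of_forall fun y => ?_)
      beta_reduce
      have hg : ⟪W y, gradient P y⟫ = fderiv ℝ P y (W y) := by
        rw [real_inner_comm, gradient, InnerProductSpace.toDual_symm_apply]
      rw [hφU y, hDφU y, inner_neg_right, sub_neg_eq_add, real_inner_smul_right,
        real_inner_smul_right, hg, real_inner_comm (U y) (fderiv ℝ U y (W y))]
      ring

end Generic

/-- **ENERGY COKERNEL FAMILY** (stub `stub_cokernelEnergy` of crux `NoFrozenEddyCollapse`, line
`SketchIdeator1`).  For a smooth compactly supported steady Euler flow `(U, P)` on `ℝ³`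
(`DU·U + ∇P = 0`, `div U = 0`) and smooth `f : ℝ → ℝ`, the Bernoulli-shell field
`φ_f = f(P + ‖U‖²/2) U` is smooth, compactly supported inside `tsupport U`, divergence free
(`div φ_f = f′(B) DB·U = 0` by Bernoulli), and annihilated by the adjoint linearised Euler operator:
`∫ (⟪U, Dφ_f W⟫ + ⟪W, Dφ_f U⟫) = 0` for every `C¹` divergence-free `W` (by parts the pairing is
`-∫ f(B) DB·W = -∫ ⟪W, ∇(F∘B - c)⟫ = 0`, `F′ = f`, `F∘B - c ∈ C¹_c` since `DB = 0` off
`tsupport U` and the exterior of a ball in `ℝ³` is connected).  Uses: `ContDiff ⊤ U, P, f`,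
`HasCompactSupport U`, `div U = 0`, the Euler equation. -/
theorem stub_cokernelEnergy :
    ∀ (U : EuclideanSpace ℝ (Fin 3) → EuclideanSpace ℝ (Fin 3)) (P : EuclideanSpace ℝ (Fin 3) → ℝ)
      (f : ℝ → ℝ),
      ContDiff ℝ (⊤ : ℕ∞) U → ContDiff ℝ (⊤ : ℕ∞) P → HasCompactSupport U →
      VectorCalculus.IsDivFree U → (∀ x, convect U U x + gradient P x = 0) → ContDiff ℝ (⊤ : ℕ∞) f →
      ContDiff ℝ (⊤ : ℕ∞) (fun y => f (P y + ‖U y‖ ^ 2 / 2) • U y) ∧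
        HasCompactSupport (fun y => f (P y + ‖U y‖ ^ 2 / 2) • U y) ∧
        tsupport (fun y => f (P y + ‖U y‖ ^ 2 / 2) • U y) ⊆ tsupport U ∧
        VectorCalculus.IsDivFree (fun y => f (P y + ‖U y‖ ^ 2 / 2) • U y) ∧
        ∀ W : EuclideanSpace ℝ (Fin 3) → EuclideanSpace ℝ (Fin 3), ContDiff ℝ 1 W →
          VectorCalculus.IsDivFree W →
          ∫ y, (inner ℝ (U y) (fderiv ℝ (fun z => f (P z + ‖U z‖ ^ 2 / 2) • U z) y (W y)) +
            inner ℝ (W y) (fderiv ℝ (fun z => f (P z + ‖U z‖ ^ 2 / 2) • U z) y (U y))) = 0 := by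
  intro U P f hU hP hUc hUdiv hEu hf
  -- regularity of `U`, `P`, `f`, the head `B`, `θ = f ∘ B` and `φ = θ U`
  have hU1 : ContDiff ℝ 1 U := hU.of_le (by exact_mod_cast le_top)
  have hUd : Differentiable ℝ U := hU1.differentiable one_ne_zero
  have hPd : Differentiable ℝ P :=
    (hP.of_le (by exact_mod_cast le_top) : ContDiff ℝ 1 P).differentiable one_ne_zero
  have hfd : Differentiable ℝ f :=
    (hf.of_le (by exact_mod_cast le_top) : ContDiff ℝ 1 f).differentiable one_ne_zero
  have hB : ContDiff ℝ (⊤ : ℕ∞) (fun z => P z + ‖U z‖ ^ 2 / 2) := contDiff_head hU hP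
  have hBd : Differentiable ℝ (fun z => P z + ‖U z‖ ^ 2 / 2) :=
    (hB.of_le (by exact_mod_cast le_top) : ContDiff ℝ 1 _).differentiable one_ne_zero
  have hθ : ContDiff ℝ (⊤ : ℕ∞) (fun z => f (P z + ‖U z‖ ^ 2 / 2)) := hf.comp hB
  have hθ1 : ContDiff ℝ 1 (fun z => f (P z + ‖U z‖ ^ 2 / 2)) := hθ.of_le (by exact_mod_cast le_top)
  have hθd : Differentiable ℝ (fun z => f (P z + ‖U z‖ ^ 2 / 2)) := hθ1.differentiable one_ne_zero
  have hφ : ContDiff ℝ (⊤ : ℕ∞) (fun y => f (P y + ‖U y‖ ^ 2 / 2) • U y) := hθ.smul hU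
  have hφ1 : ContDiff ℝ 1 (fun y => f (P y + ‖U y‖ ^ 2 / 2) • U y) :=
    hφ.of_le (by exact_mod_cast le_top)
  have hφc : HasCompactSupport (fun y => f (P y + ‖U y‖ ^ 2 / 2) • U y) :=
    hUc.mono (support_smul_subset_right (fun y => f (P y + ‖U y‖ ^ 2 / 2)) U)
  -- Bernoulli: `Dθ·U = f′(B) DB·U = 0`
  have hθU : ∀ y, fderiv ℝ (fun z => f (P z + ‖U z‖ ^ 2 / 2)) y (U y) = 0 := fun y => by
    have h : HasFDerivAt (fun z => f (P z + ‖U z‖ ^ 2 / 2))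
        (deriv f (P y + ‖U y‖ ^ 2 / 2) • fderiv ℝ (fun z => P z + ‖U z‖ ^ 2 / 2) y) y :=
      (hfd _).hasDerivAt.comp_hasFDerivAt y (hBd y).hasFDerivAt
    rw [h.fderiv, _root_.smul_apply, fderiv_head_apply_self hUd hPd hEu y, smul_zero]
  -- `Dφ·U = θ DU·U = -θ ∇P`
  have hDφU : ∀ y, fderiv ℝ (fun z => f (P z + ‖U z‖ ^ 2 / 2) • U z) y (U y) =
      -(f (P y + ‖U y‖ ^ 2 / 2) • gradient P y) := fun y => by
    have h1 : fderiv ℝ U y (U y) = -gradient P y := eq_neg_of_add_eq_zero_left (hEu y)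
    rw [fderiv_fun_smul (hθd y) (hUd y)]
    simp only [_root_.add_apply, _root_.smul_apply, ContinuousLinearMap.smulRight_apply, hθU y,
      zero_smul, add_zero, h1, smul_neg]
  refine ⟨hφ, hφc, tsupport_smul_subset_right (fun y => f (P y + ‖U y‖ ^ 2 / 2)) U, ?_, ?_⟩
  · -- divergence free: `div (θ U) = θ div U + ⟪U, ∇θ⟫ = 0 + Dθ·U = 0`
    intro x
    rw [divergence_smul_apply (hθd x) (hUd x), hUdiv x, mul_zero, zero_add, real_inner_comm,
      gradient, InnerProductSpace.toDual_symm_apply]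
    exact hθU x
  · -- the cokernel identity
    intro W hW hWdiv
    have hrank : 1 < Module.rank ℝ (EuclideanSpace ℝ (Fin 3)) :=
      Module.one_lt_rank_of_one_lt_finrank (by rw [finrank_euclideanSpace_fin]; norm_num)
    refine (integral_cokernel_pairing hU1 hUc hφ1 hφc (fun y => rfl) hDφU hW hWdiv).trans ?_
    rw [neg_eq_zero]
    refine (integral_congr_ae (Eventually.of_forall fun y => ?_)).trans
      (integral_mul_fderiv_apply_eq_zero hrank hB hUc.isCompact
        (fun y hy => fderiv_head_eq_zero hUd hPd hEu hy) hf hW hWdiv)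
    rw [fderiv_head_apply hUd hPd]

end Summit.NavierStokesRegularity.NavierStokesRegularity.Theorems.NoFrozenEddyCollapse.ShellBalanceEdgeTorsion
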